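import Summits.AtomisticToContinuum.Crystallization.Theses.FluxTubeKepler
import Summits.AtomisticToContinuum.Crystallization.Theorems.PerronTransitivityTransitiveLocalLimitOfLayeredWindows
import Summits.AtomisticToContinuum.Crystallization.Theorems.FluxTubeKeplerFluxCellKeplerGoodSitesWindows

/-!
# Line `Sketch` — skeleton v2 for crux `FluxTubeKepler.FluxCellKepler` (lead prover; the `birth` cut with the minimiser stub eliminated)

Lead (continuation c1): prover-line-stmt-AtomisticToContinuum-15221-c1-0. RESHAPE of the registered
skeleton (sha 5e703f0e…): the open stub `stub_periodicMinimiser` (= shared item 0627) is REMOVED —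
it follows from `stub_defectPricedExcess` through PROVED tree theorems: along Lennard-Jones ground
states (`LennardJonesGroundStatesExist_holds`, uniformly separated by
`LennardJonesMinimalDistance_holds`) the τ-free pricing and `E(N)/N → e*`
(`ChargedEnergyGapNegative.crysEnergyLimit`) leave fewer than `N` bad sites at every scale for
large `N`, hence a layered-good site; the new potential-free compactness stub
`stub_layeredWindowsOfGoodSites` (good sites at every scale, frequently in `N` ⇒ ONE in-layer
spacing serving every scale: the accumulation-point pattern `hb_window_rescale` /
`hb_exists_global_spacing_freq` of `PhononSlackCertificatesHullBridgeWindows`) turns this into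
`HullMinimality.LayeredWindows`, and
`TransitiveLocalLimitMotifTwo.crysPeriodicMinAttained_of_layeredWindows` (landed) gives the
periodic minimiser. Stubs now: `stub_defectPricedExcess` (open core, held by the lead),
`stub_coerciveFluxCells` (the line's bet); `stub_layeredWindowsOfGoodSites` LANDED (p164329) and
is used inside `FluxCellKepler_of`.

STATE OF THE TWO OPEN STUBS (lead c1, cycle 1):
* `stub_defectPricedExcess` ⇐ `PhononSlackCertificates.CoerciveTwoShellGap` (item 13956) ∧
  `PhononSlackCertificates.NearFieldConvexity` (item 13958): certified in
  `Theorems/FluxTubeKeplerFluxCellKeplerDefectPricedOfGaps.lean`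
  (`FluxCellKeplerSketchGaps.stub_defectPricedExcess_of_gaps`, t-controlled gluing by compactness +
  exact layered rigidity, then counting); conversely it implies `HullMinimality.LayeredWindows`,
  item 0627 and the whole sub-problem `Crystallization`
  (`Theorems/FluxTubeKeplerFluxCellKeplerPricingConsequences.lean`). It is the board's generic
  quantitative-crystallization statement; blocked on 13956 / 13958 (or a direct proof).
* `stub_coerciveFluxCells`: blocked on `FluxTubeKepler.FluxTubeBound` (item 15225, Thomson
  flux-tube domination) plus the undefined flux-tube functional / facet-flux rule; necessary
  conditions on any witness certified in
  `Theorems/FluxTubeKeplerFluxCellKeplerCoerciveConstraints.lean` (p165216: `0 < R₁`,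
  `R₁⁻⁶ ≤ τ{0} ≤ 12 θ |e*|`, `θ ≥ R₁⁻⁶/(12|e*|) > 0`).
The previous header follows.

## (v1, prover-line-stmt-AtomisticToContinuum-15221-0)

This is the TRANSVERSAL composition of
`Lines/birth.lean` (planner-skel, vetted PASS 2026-08-17, sha 2c0d639a), kept verbatim as the
registered stub set of line `Sketch`; the Sketch family of crux ideas (cards
`pythagoras-registered-ledger`, `single-scale-collapse`, `flux-cell-m-potential`,
`pohozaev-pressure-ledger`) enters BELOW the stubs: the explicit registered-ledger credit `τ⁺` is
the intended witness of `stub_coerciveFluxCells`, and the transfer principle / pointwise-envelope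
summation / single-scale monotonicity are layer-2 lemmas landed `--supports` by the lead.
Original birth header follows.

## (birth)

Item `stmt-AtomisticToContinuum-15221` (crux, rank 2, route `FluxTubeKepler`, sub-problem
`Crystallization`). The crux `X = FluxCellKepler` is the FLUX-CELL KEPLER INEQUALITY: there are a
periodic `P₀`, a radius `R₁` and a LOCAL tail credit `τ` (a real function of the pattern of relative
positions within `R₁` of a site) such that

* (DOM) `Σ_i site₆(x)_i ≤ Σ_i τ(pattern_i)` on every finite injective configuration, and
* (KEPLER) for every `δ > 0` and `R, η > 0` some `c > 0` with
  `c · #bad_{R,η}(x) ≤ Σ_i ((1/24) site₁₂(x)_i − (1/12) τ(pattern_i)) − N · e(P₀)` on every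
  `δ`-separated finite injective configuration (`bad` = sites whose `R`-neighbourhood is not
  `η`-matched two ways with a member of the relaxed Barlow / layered family).

The two conjuncts share the witness `τ`, so `X` cannot be cut into "DOM" and "KEPLER" without
naming `τ` (by monotonicity in `τ`, "∃ τ, KEPLER" alone is already `X`). The birth cut is
TRANSVERSAL instead — it separates the three things a proof of `X` must deliver:

* `stub_periodicMinimiser` — a periodic minimiser `P₀` of the Lennard-Jones energy per particle
  EXISTS (verbatim the shared open item `stmt-AtomisticToContinuum-0627`, `CrysPeriodicMinAttained`).
  A consequence of `X` (KEPLER on chunks of periodic `Q` forces `e(P₀) = e* = min`); open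
  (stacking selection among Barlow polytypes); size L.
* `stub_defectPricedExcess` — the `τ`-FREE shadow of KEPLER, i.e. QUANTITATIVE CRYSTALLIZATION onto
  the layered family: for every `δ, R, η > 0` some `c > 0` with `c · #bad_{R,η}(x) ≤ E(x) − N · e*`
  on every `δ`-separated finite configuration, `e* = ⨅_Q e(Q)` the periodic infimum. A consequence
  of `X` (DOM + the energy identity `E = Σ_i ((1/24) site₁₂ − (1/12) site₆)` + `e(P₀) = e*`); it is
  the Hales/Kepler content of the crux with the true (non-local) tail in place of the cell credit;
  open, XL (it is what the route's transfer step `OneCentreTable → FacetTransfer` must prove, read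
  globally).
* `stub_coerciveFluxCells` — COERCIVE FLUX-CELL LOCALISATION of the tail (the Thomson / flux-tube
  content of the route, card `flux-tube-thomson-8d`): there are `R₁` and a local credit `τ` with DOM
  on all finite configurations and, for every `δ > 0`, some `θ < 1` with
  `Σ_i τ_i − Σ_i site₆,i ≤ 12 θ (E(x) − N e*)` on `δ`-separated configurations — in the card's
  Bogomolny split `E = Σ_i λ_i + 𝔖/12`, the confinement defect `𝔖 = Σ τ − Σ site₆ ≥ 0` eats at
  most a `θ`-fraction of the excess energy, i.e. the cell functional `Σ λ` keeps a fixed fraction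
  `(1 − θ)` of every configuration's excess over the crystal floor. NOT a consequence of `X` (which
  only gives `θ = 1`, useless for the assembly): it is the line's bet — with a facet-flux rule that
  tracks strain to first order, `𝔖 = O(strain⁴)` while the excess is `O(strain²)`; it fails if the
  cell functional has a soft mode the true energy lacks, or if disordered (icosahedral-rich) packings
  carry confinement defect comparable to their whole excess at every admissible flux rule. Size XL.

Assembly `FluxCellKepler_of` (real proof, no `sorry`): `P₀` from stub 1, so `e(P₀) = e*`
(`IsLeast.csInf_eq`, `sInf_range`); `(R₁, τ)` and DOM from stub 3; given `δ, R, η` take `θ` from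
stub 3 and `c` from stub 2 and put `c' := (1 − θ) c > 0`; by the energy identity
`Σ_i λ_i = E − (Σ τ − Σ site₆)/12 ≥ E − θ (E − N e*)`, hence
`Σ_i λ_i − N e(P₀) ≥ (1 − θ)(E − N e*) ≥ (1 − θ) c · #bad = c' · #bad`. The identity is proved
here (`interactionEnergy_lennardJones_eq_sum`) from `two_mul_interactionEnergy` and the definition
of `lennardJones`, so the constants `1/24`, `1/12` of the crux are certified by the kernel.
`FluxCellKepler_skeleton : FluxCellKepler` applies it to the three sorried stubs (the only `sorry`s).
-/

namespace Summit.AtomisticToContinuum.Crystallization.Cruxes.FluxCellKepler.Sketch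

open scoped BigOperators
open Literature.MathematicalPhysics.StatisticalMechanics

/-! ## The declared stubs (the only `sorry`s of the file; stub A is landed and re-exported) -/

/-- **Stub A — layered windows from good sites (potential-free compactness in the spacing).** For
ANY sequence of finite configurations `x N`: if for every scale `(R, η)` (`R, η > 0`), frequently in
`N`, some site of `x N` is `(R, η)`-layered-good (its `R`-neighbourhood of relative positions is
two-way `η`-matched with a member of the relaxed Barlow / layered family of SOME spacing
`a ∈ [47/50, 1]`), then ONE spacing `a ∈ [47/50, 1]` serves every scale: for every `(R, ε)`,
frequently in `N`, some translate `x N + t` is two-way `ε`-matched on `B(0, R)` with a layered set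
of spacing `a` (verbatim the window clause of `HullMinimality.LayeredWindows`). Proof pattern (in
tree): a good site `i` at scale `(2R+1, ε/2)` with spacing `a'` is a window with `t = -x N i`;
the homothety of ratio `a/a'` (heights rescaled with it, so the increment box is kept) turns it
into an `(R, ε)`-window of any spacing `a` with `|a − a'| ≤ ε/(8(R+1))`
(`hb_window_rescale`); an accumulation point of the spacings along a diagonal extraction serves
all scales (`hb_exists_global_spacing_freq`, `hb_window_mono`, `hb_window_neg`). LANDED
(p164329, `FluxCellKeplerSketch.stub_layeredWindowsOfGoodSites`); re-exported here. [folklore] -/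
theorem stub_layeredWindowsOfGoodSites :
    ∀ x : (N : ℕ) → (Fin N → EuclideanSpace ℝ (Fin 3)),
      (∀ R η : ℝ, 0 < R → 0 < η → ∃ᶠ N in Filter.atTop, ∃ i : Fin N, ∃ a : ℝ, 47 / 50 ≤ a ∧ a ≤ 1 ∧ ∃ (A : EuclideanSpace ℝ (Fin 3) →ₗᵢ[ℝ] EuclideanSpace ℝ (Fin 3)) (s : ℤ → ℤ) (z : ℤ → ℝ), IsHaggSeq s ∧ (∀ m : ℤ, 39 / 50 * a ≤ z (m + 1) - z m ∧ z (m + 1) - z m ≤ 17 / 20 * a) ∧ let S : Set (EuclideanSpace ℝ (Fin 3)) := {p | ∃ m k l : ℤ, p = A (((k : ℝ) • triangularVec₁ a) + ((l : ℝ) • triangularVec₂ a) + ((haggLabel s m : ℝ) • barlowOffset a) + (z m • layerNormal 1))}; (∀ p ∈ S, ‖p‖ ≤ R → ∃ j : Fin N, dist (x N j - x N i) p ≤ η) ∧ (∀ j : Fin N, ‖x N j - x N i‖ ≤ R → ∃ p ∈ S, dist (x N j - x N i) p ≤ η)) →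
      ∃ a : ℝ, 47 / 50 ≤ a ∧ a ≤ 1 ∧ ∀ R ε : ℝ, 0 < ε → ∃ᶠ N in Filter.atTop, ∃ (A : EuclideanSpace ℝ (Fin 3) →ₗᵢ[ℝ] EuclideanSpace ℝ (Fin 3)) (t : EuclideanSpace ℝ (Fin 3)) (s : ℤ → ℤ) (z : ℤ → ℝ), IsHaggSeq s ∧ (∀ m : ℤ, 39 / 50 * a ≤ z (m + 1) - z m ∧ z (m + 1) - z m ≤ 17 / 20 * a) ∧ let S : Set (EuclideanSpace ℝ (Fin 3)) := {p | ∃ m i j : ℤ, p = A (((i : ℝ) • triangularVec₁ a) + ((j : ℝ) • triangularVec₂ a) + ((haggLabel s m : ℝ) • barlowOffset a) + (z m • layerNormal 1))}; (∀ p ∈ S, ‖p‖ ≤ R → ∃ i : Fin N, dist (x N i + t) p ≤ ε) ∧ (∀ i : Fin N, ‖x N i + t‖ ≤ R → ∃ p ∈ S, dist (x N i + t) p ≤ ε) :=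
  -- LANDED p164329 (worker, wave 1): Theorems/FluxTubeKeplerFluxCellKeplerGoodSitesWindows.lean
  Summit.AtomisticToContinuum.Crystallization.Theorems.FluxCellKeplerSketch.stub_layeredWindowsOfGoodSites

/-- **Stub 2 — defect-priced excess energy (τ-free quantitative crystallization onto the layered
family).** For every separation `δ > 0` and every pattern test `(R, η)` there is `c > 0` such that on
every finite `δ`-separated configuration of distinct points the Lennard-Jones energy exceeds
`N · e*` (`e*` = the periodic infimum of the energy per particle) by at least `c` per site whose
`R`-neighbourhood is not two-way `η`-matched with a member of the relaxed Barlow / layered family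
(spacing `a ∈ [47/50, 1]`, free Hägg word, interlayer increments in `[39a/50, 17a/20]`). The
Kepler content of the crux with the true tail in place of the cell credit (crux ⇒ stub 2 by DOM and
the energy identity); `c(R, η)` may be as small as `μ (η/R)²` (uniform strain); false iff a
non-layered competitor (amorphous / Frank–Kasper) ties `e*` in energy density. [conjecture] -/
theorem stub_defectPricedExcess :
    ∀ δ : ℝ, 0 < δ → ∀ R η : ℝ, 0 < R → 0 < η → ∃ c : ℝ, 0 < c ∧
      ∀ (N : ℕ) (x : Fin N → EuclideanSpace ℝ (Fin 3)), Function.Injective x →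
        (∀ i j, i ≠ j → δ ≤ dist (x i) (x j)) →
        c * (Nat.card {i : Fin N // ¬ ∃ a : ℝ, 47 / 50 ≤ a ∧ a ≤ 1 ∧ ∃ (A : EuclideanSpace ℝ (Fin 3) →ₗᵢ[ℝ] EuclideanSpace ℝ (Fin 3)) (s : ℤ → ℤ) (z : ℤ → ℝ), IsHaggSeq s ∧ (∀ m : ℤ, 39 / 50 * a ≤ z (m + 1) - z m ∧ z (m + 1) - z m ≤ 17 / 20 * a) ∧ let S : Set (EuclideanSpace ℝ (Fin 3)) := {p | ∃ m k l : ℤ, p = A (((k : ℝ) • triangularVec₁ a) + ((l : ℝ) • triangularVec₂ a) + ((haggLabel s m : ℝ) • barlowOffset a) + (z m • layerNormal 1))}; (∀ p ∈ S, ‖p‖ ≤ R → ∃ j : Fin N, dist (x j - x i) p ≤ η) ∧ (∀ j : Fin N, ‖x j - x i‖ ≤ R → ∃ p ∈ S, dist (x j - x i) p ≤ η)} : ℝ)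
          ≤ interactionEnergy lennardJones x
              - (N : ℝ) * ⨅ Q : PeriodicConfiguration 3, Q.energyPerParticle lennardJones := by
  sorry

/-- **Stub 3 — coercive flux-cell localisation of the `r⁻⁶` tail** (the Thomson / flux-tube content).
There are a radius `R₁` and a LOCAL tail credit `τ` (a function of the pattern of relative positions
within `R₁`) such that (DOM) `Σ_i site₆,i ≤ Σ_i τ(pattern_i)` on every finite injective
configuration, and (θ-SHARPNESS) for every `δ > 0` some `θ < 1` with
`Σ_i τ(pattern_i) − Σ_i site₆,i ≤ 12 θ (E(x) − N e*)` on every `δ`-separated finite injective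
configuration: the over-credit (the card's confinement defect `𝔖 ≥ 0` in `E = Σ λ + 𝔖/12`) is at
most a `θ`-fraction of the excess energy. Intended `τ = 2π⁴ (T(Vor_i ∩ B(R₁/2), x_i; q) − T(ℝ³))`
(8-D flux-tube energies with a local antisymmetric facet-flux rule `q` exact on Barlow bond types
and linear in strain), DOM = Thomson's principle; sharpness = `𝔖 = O(strain⁴)` near the layered
family and a definite margin on disordered cells. Not implied by the crux (which gives `θ = 1`);
fails if the cell functional has a soft mode the true energy lacks, or if some disordered packing
family has `𝔖 / (12 (E − N e*)) → 1` for every admissible local credit. [conjecture] -/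
theorem stub_coerciveFluxCells :
    ∃ (R₁ : ℝ) (τ : Finset (EuclideanSpace ℝ (Fin 3)) → ℝ),
      (∀ (N : ℕ) (x : Fin N → EuclideanSpace ℝ (Fin 3)), Function.Injective x →
        ∑ i, siteEnergy (fun r => (r⁻¹) ^ 6) x i
          ≤ ∑ i, τ ((Finset.univ.filter fun j : Fin N => dist (x j) (x i) ≤ R₁).image fun j => x j - x i)) ∧
      (∀ δ : ℝ, 0 < δ → ∃ θ : ℝ, θ < 1 ∧
        ∀ (N : ℕ) (x : Fin N → EuclideanSpace ℝ (Fin 3)), Function.Injective x →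
          (∀ i j, i ≠ j → δ ≤ dist (x i) (x j)) →
          ∑ i, τ ((Finset.univ.filter fun j : Fin N => dist (x j) (x i) ≤ R₁).image fun j => x j - x i)
              - ∑ i, siteEnergy (fun r => (r⁻¹) ^ 6) x i
            ≤ 12 * θ * (interactionEnergy lennardJones x
                - (N : ℝ) * ⨅ Q : PeriodicConfiguration 3, Q.energyPerParticle lennardJones)) := by
  sorry

/-! ## Assembly lemma (sorry-free): the energy identity with the crux's constants -/

/-- `E_LJ(x) = Σ_i ((1/24) site₁₂(x)_i − (1/12) site₆(x)_i)`: double counting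
(`two_mul_interactionEnergy`) and `V_LJ(r) = (1/12) r⁻¹² − (1/6) r⁻⁶`. This certifies the pairing
of the constants `1/24, 1/12` in the crux with the tree's normalisation. [folklore] -/
theorem interactionEnergy_lennardJones_eq_sum {N : ℕ} (x : Fin N → EuclideanSpace ℝ (Fin 3)) :
    interactionEnergy lennardJones x
      = ∑ i, ((1 / 24 : ℝ) * siteEnergy (fun r => (r⁻¹) ^ 12) x i
          - (1 / 12 : ℝ) * siteEnergy (fun r => (r⁻¹) ^ 6) x i) := by
  have h2 := two_mul_interactionEnergy lennardJones x
  have hsite : ∀ i : Fin N, siteEnergy lennardJones x i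
      = (1 / 12 : ℝ) * siteEnergy (fun r => (r⁻¹) ^ 12) x i
          - (1 / 6 : ℝ) * siteEnergy (fun r => (r⁻¹) ^ 6) x i := by
    intro i
    simp only [siteEnergy, lennardJones, Finset.sum_sub_distrib, Finset.mul_sum]
  rw [Finset.sum_congr rfl fun i _ => hsite i] at h2
  have hE : interactionEnergy lennardJones x
      = (1 / 2 : ℝ) * ∑ i, ((1 / 12 : ℝ) * siteEnergy (fun r => (r⁻¹) ^ 12) x i
          - (1 / 6 : ℝ) * siteEnergy (fun r => (r⁻¹) ^ 6) x i) := by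
    linarith
  rw [hE, Finset.mul_sum]
  exact Finset.sum_congr rfl fun i _ => by ring

/-! ## The stub statements as named propositions (verbatim the stub signatures) -/

/-- Statement of `stub_layeredWindowsOfGoodSites` (verbatim). [folklore] -/
def Sig.stub_layeredWindowsOfGoodSites : Prop :=
  ∀ x : (N : ℕ) → (Fin N → EuclideanSpace ℝ (Fin 3)),
      (∀ R η : ℝ, 0 < R → 0 < η → ∃ᶠ N in Filter.atTop, ∃ i : Fin N, ∃ a : ℝ, 47 / 50 ≤ a ∧ a ≤ 1 ∧ ∃ (A : EuclideanSpace ℝ (Fin 3) →ₗᵢ[ℝ] EuclideanSpace ℝ (Fin 3)) (s : ℤ → ℤ) (z : ℤ → ℝ), IsHaggSeq s ∧ (∀ m : ℤ, 39 / 50 * a ≤ z (m + 1) - z m ∧ z (m + 1) - z m ≤ 17 / 20 * a) ∧ let S : Set (EuclideanSpace ℝ (Fin 3)) := {p | ∃ m k l : ℤ, p = A (((k : ℝ) • triangularVec₁ a) + ((l : ℝ) • triangularVec₂ a) + ((haggLabel s m : ℝ) • barlowOffset a) + (z m • layerNormal 1))}; (∀ p ∈ S, ‖p‖ ≤ R →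 ∃ j : Fin N, dist (x N j - x N i) p ≤ η) ∧ (∀ j : Fin N, ‖x N j - x N i‖ ≤ R → ∃ p ∈ S, dist (x N j - x N i) p ≤ η)) →
      ∃ a : ℝ, 47 / 50 ≤ a ∧ a ≤ 1 ∧ ∀ R ε : ℝ, 0 < ε → ∃ᶠ N in Filter.atTop, ∃ (A : EuclideanSpace ℝ (Fin 3) →ₗᵢ[ℝ] EuclideanSpace ℝ (Fin 3)) (t : EuclideanSpace ℝ (Fin 3)) (s : ℤ → ℤ) (z : ℤ → ℝ), IsHaggSeq s ∧ (∀ m : ℤ, 39 / 50 * a ≤ z (m + 1) - z m ∧ z (m + 1) - z m ≤ 17 / 20 * a) ∧ let S : Set (EuclideanSpace ℝ (Fin 3)) := {p | ∃ m i j : ℤ, p = A (((i : ℝ) • triangularVec₁ a) + ((j : ℝ) • triangularVec₂ a) + ((haggLabel s m : ℝ) • barlowOffset a) + (z m • layerNormal 1))}; (∀ p ∈ S, ‖p‖ ≤ R → ∃ i : Fin N, dist (x N i + t) p ≤ ε) ∧ (∀ i : Fin N, ‖x N i + t‖ ≤ R → ∃ p ∈ S, dist (x N i + t) p ≤ ε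)

/-- Statement of `stub_defectPricedExcess` (verbatim). [conjecture] -/
def Sig.stub_defectPricedExcess : Prop :=
  ∀ δ : ℝ, 0 < δ → ∀ R η : ℝ, 0 < R → 0 < η → ∃ c : ℝ, 0 < c ∧
      ∀ (N : ℕ) (x : Fin N → EuclideanSpace ℝ (Fin 3)), Function.Injective x →
        (∀ i j, i ≠ j → δ ≤ dist (x i) (x j)) →
        c * (Nat.card {i : Fin N // ¬ ∃ a : ℝ, 47 / 50 ≤ a ∧ a ≤ 1 ∧ ∃ (A : EuclideanSpace ℝ (Fin 3) →ₗᵢ[ℝ] EuclideanSpace ℝ (Fin 3)) (s : ℤ → ℤ) (z : ℤ → ℝ), IsHaggSeq s ∧ (∀ m : ℤ, 39 / 50 * a ≤ z (m + 1) - z m ∧ z (m + 1) - z m ≤ 17 / 20 * a) ∧ let S : Set (EuclideanSpace ℝ (Fin 3)) := {p | ∃ m k l : ℤ, p = A (((k : ℝ) • triangularVec₁ a) + ((l : ℝ) • triangularVec₂ a) + ((haggLabel s m : ℝ) • barlowOffset a) + (z m • layerNormal 1))}; (∀ p ∈ S, ‖p‖ ≤ R → ∃ j : Fin N, dist (x j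 - x i) p ≤ η) ∧ (∀ j : Fin N, ‖x j - x i‖ ≤ R → ∃ p ∈ S, dist (x j - x i) p ≤ η)} : ℝ)
          ≤ interactionEnergy lennardJones x
              - (N : ℝ) * ⨅ Q : PeriodicConfiguration 3, Q.energyPerParticle lennardJones

/-- Statement of `stub_coerciveFluxCells` (verbatim). [conjecture] -/
def Sig.stub_coerciveFluxCells : Prop :=
  ∃ (R₁ : ℝ) (τ : Finset (EuclideanSpace ℝ (Fin 3)) → ℝ),
      (∀ (N : ℕ) (x : Fin N → EuclideanSpace ℝ (Fin 3)), Function.Injective x →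
        ∑ i, siteEnergy (fun r => (r⁻¹) ^ 6) x i
          ≤ ∑ i, τ ((Finset.univ.filter fun j : Fin N => dist (x j) (x i) ≤ R₁).image fun j => x j - x i)) ∧
      (∀ δ : ℝ, 0 < δ → ∃ θ : ℝ, θ < 1 ∧
        ∀ (N : ℕ) (x : Fin N → EuclideanSpace ℝ (Fin 3)), Function.Injective x →
          (∀ i j, i ≠ j → δ ≤ dist (x i) (x j)) →
          ∑ i, τ ((Finset.univ.filter fun j : Fin N => dist (x j) (x i) ≤ R₁).image fun j => x j - x i)
              - ∑ i, siteEnergy (fun r => (r⁻¹) ^ 6) x i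
            ≤ 12 * θ * (interactionEnergy lennardJones x
                - (N : ℝ) * ⨅ Q : PeriodicConfiguration 3, Q.energyPerParticle lennardJones))

/-! ## Assembly lemmas (sorry-free): layered windows and the periodic minimiser from the pricing -/

/-- **Good sites along ground states from the τ-free pricing.** Under `stub_defectPricedExcess`,
for every scale `(R, η)` and every sequence of Lennard-Jones ground states, for all large `N` some
site of `x N` is `(R, η)`-layered-good: ground states are uniformly `δ₀`-separated
(`LennardJonesMinimalDistance_holds`), the pricing at `(δ₀, R, η)` gives
`c · #bad ≤ E(N) − N e*`, and `E(N)/N → e*` (`crysEnergyLimit`) makes the right-hand side `< c N`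
eventually, so not all `N` sites are bad. [folklore] -/
theorem eventually_exists_good_of_pricing (h₂ : Sig.stub_defectPricedExcess)
    (x : (N : ℕ) → (Fin N → EuclideanSpace ℝ (Fin 3))) (hx : ∀ N, IsGroundState lennardJones (x N))
    (R η : ℝ) (hR : 0 < R) (hη : 0 < η) :
    ∀ᶠ N in Filter.atTop, ∃ i : Fin N, ∃ a : ℝ, 47 / 50 ≤ a ∧ a ≤ 1 ∧ ∃ (A : EuclideanSpace ℝ (Fin 3) →ₗᵢ[ℝ] EuclideanSpace ℝ (Fin 3)) (s : ℤ → ℤ) (z : ℤ → ℝ), IsHaggSeq s ∧ (∀ m : ℤ, 39 / 50 * a ≤ z (m + 1) - z m ∧ z (m + 1) - z m ≤ 17 / 20 * a) ∧ let S : Set (EuclideanSpace ℝ (Fin 3)) := {p | ∃ m k l : ℤ, p = A (((k : ℝ) • triangularVec₁ a) + ((l : ℝ) • triangularVec₂ a) + ((haggLabel s m : ℝ) • barlowOffset a) + (z m • layerNormal 1))}; (∀ p ∈ S, ‖p‖ ≤ R → ∃ j : Fin N, dist (x N j - x N i) p ≤ η) ∧ (∀ j : Fin N, ‖x N j - x N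 i‖ ≤ R → ∃ p ∈ S, dist (x N j - x N i) p ≤ η) := by
  obtain ⟨δ₀, hδ₀, hsepGS⟩ := LennardJonesMinimalDistance_holds
  obtain ⟨c, hc, hcb⟩ := h₂ δ₀ hδ₀ R η hR hη
  have hlim :=
    Summit.AtomisticToContinuum.Crystallization.Theorems.ChargedEnergyGapNegative.crysEnergyLimit
  set e : ℝ := ⨅ Q : PeriodicConfiguration 3, Q.energyPerParticle lennardJones with he
  have hev : ∀ᶠ N : ℕ in Filter.atTop, groundStateEnergy lennardJones 3 N / N < e + c :=
    hlim (Iio_mem_nhds (by linarith))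
  filter_upwards [hev, Filter.eventually_ge_atTop 1] with N hN hN1
  by_contra hall
  rw [not_exists] at hall
  have hcard : Nat.card {i : Fin N // ¬ ∃ a : ℝ, 47 / 50 ≤ a ∧ a ≤ 1 ∧ ∃ (A : EuclideanSpace ℝ (Fin 3) →ₗᵢ[ℝ] EuclideanSpace ℝ (Fin 3)) (s : ℤ → ℤ) (z : ℤ → ℝ), IsHaggSeq s ∧ (∀ m : ℤ, 39 / 50 * a ≤ z (m + 1) - z m ∧ z (m + 1) - z m ≤ 17 / 20 * a) ∧ let S : Set (EuclideanSpace ℝ (Fin 3)) := {p | ∃ m k l : ℤ, p = A (((k : ℝ) • triangularVec₁ a) + ((l : ℝ) • triangularVec₂ a) + ((haggLabel s m : ℝ) • barlowOffset a) + (z m • layerNormal 1))}; (∀ p ∈ S, ‖p‖ ≤ R → ∃ j : Fin N, dist (x N j - x N i) p ≤ η) ∧ (∀ j : Fin N, ‖x N j - x N i‖ ≤ R → ∃ p ∈ S, dist (x N j - x N i) p ≤ η)} = N := by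
    rw [Nat.card_congr (Equiv.subtypeUnivEquiv hall), Nat.card_eq_fintype_card, Fintype.card_fin]
  have hkey := hcb N (x N) (hx N).1 (hsepGS N (x N) (hx N))
  rw [hcard, (hx N).2] at hkey
  have hNr : (0 : ℝ) < N := by exact_mod_cast hN1
  rw [div_lt_iff₀ hNr] at hN
  nlinarith

/-- **Layered windows from the pricing** (`HullMinimality.LayeredWindows`, item 11778, for the
purposes of this composition): good sites eventually at every scale
(`eventually_exists_good_of_pricing`) and the compactness stub `stub_layeredWindowsOfGoodSites`.
[folklore] -/
theorem layeredWindows_of_pricing (h₂ : Sig.stub_defectPricedExcess) :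
    Summit.AtomisticToContinuum.Crystallization.Theses.HullMinimality.LayeredWindows := by
  intro x hx
  exact stub_layeredWindowsOfGoodSites x fun R η hR hη =>
    (eventually_exists_good_of_pricing h₂ x hx R η hR hη).frequently

/-- **The periodic minimiser from the pricing** (the former stub `stub_periodicMinimiser`, item
0627, now DERIVED): `layeredWindows_of_pricing` and the landed
`TransitiveLocalLimitMotifTwo.crysPeriodicMinAttained_of_layeredWindows`. [folklore] -/
theorem periodicMinimiser_of_pricing (h₂ : Sig.stub_defectPricedExcess) :
    ∃ P : PeriodicConfiguration 3,
      IsLeast (Set.range fun Q : PeriodicConfiguration 3 => Q.energyPerParticle lennardJones)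
        (P.energyPerParticle lennardJones) :=
  Summit.AtomisticToContinuum.Crystallization.Theorems.TransitiveLocalLimitMotifTwo.crysPeriodicMinAttained_of_layeredWindows
    (layeredWindows_of_pricing h₂)

/-! ## The skeleton theorem: the crux BY NAME from the three stub statements (sorry-free) -/

/-- **Assembly.** `stub_defectPricedExcess → stub_coerciveFluxCells → FluxCellKepler` (the route's
crux decl, by name), sorry-free (the landed `stub_layeredWindowsOfGoodSites` is used inside). Take the
minimiser `P₀` of `periodicMinimiser_of_pricing`, so `e(P₀) = e*`; take `(R₁, τ)` and DOM from
stub 3; given `δ, R, η`, take `θ < 1` from stub 3 and `c > 0` from stub 2 and set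
`c' := (1 − θ) c`. On a `δ`-separated `x`, by the energy identity
`Σ_i ((1/24) site₁₂ − (1/12) τ_i) = E − (Σ τ − Σ site₆)/12 ≥ E − θ (E − N e*)`, so the cell sum
exceeds `N e(P₀) = N e*` by at least `(1 − θ)(E − N e*) ≥ (1 − θ) c · #bad`. [folklore] -/
theorem FluxCellKepler_of (h₂ : Sig.stub_defectPricedExcess) (h₃ : Sig.stub_coerciveFluxCells) :
    Summit.AtomisticToContinuum.Crystallization.Theses.FluxTubeKepler.FluxCellKepler := by
  obtain ⟨P₀, hP₀⟩ := periodicMinimiser_of_pricing h₂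
  obtain ⟨R₁, τ, hdom, hsharp⟩ := h₃
  have he : (⨅ Q : PeriodicConfiguration 3, Q.energyPerParticle lennardJones)
      = P₀.energyPerParticle lennardJones := by
    rw [← sInf_range]
    exact hP₀.csInf_eq
  refine ⟨P₀, R₁, τ, hdom, ?_⟩
  intro δ hδ R η hR hη
  obtain ⟨θ, hθ, hθb⟩ := hsharp δ hδ
  obtain ⟨c, hc, hcb⟩ := h₂ δ hδ R η hR hη
  refine ⟨(1 - θ) * c, mul_pos (sub_pos.2 hθ) hc, ?_⟩
  intro N x hx hsep
  have hG := hcb N x hx hsep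
  have hL := hθb N x hx hsep
  rw [he] at hG hL
  have hsum : ∑ i, ((1 / 24 : ℝ) * siteEnergy (fun r => (r⁻¹) ^ 12) x i
        - (1 / 12 : ℝ) * τ ((Finset.univ.filter fun j : Fin N => dist (x j) (x i) ≤ R₁).image fun j => x j - x i))
      = interactionEnergy lennardJones x
        - (1 / 12 : ℝ) * (∑ i, τ ((Finset.univ.filter fun j : Fin N => dist (x j) (x i) ≤ R₁).image fun j => x j - x i)
            - ∑ i, siteEnergy (fun r => (r⁻¹) ^ 6) x i) := by
    rw [interactionEnergy_lennardJones_eq_sum, Finset.sum_sub_distrib, Finset.sum_sub_distrib,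
      ← Finset.mul_sum, ← Finset.mul_sum, ← Finset.mul_sum]
    ring
  rw [hsum]
  have h1 : (1 - θ) * (c * (Nat.card {i : Fin N // ¬ ∃ a : ℝ, 47 / 50 ≤ a ∧ a ≤ 1 ∧ ∃ (A : EuclideanSpace ℝ (Fin 3) →ₗᵢ[ℝ] EuclideanSpace ℝ (Fin 3)) (s : ℤ → ℤ) (z : ℤ → ℝ), IsHaggSeq s ∧ (∀ m : ℤ, 39 / 50 * a ≤ z (m + 1) - z m ∧ z (m + 1) - z m ≤ 17 / 20 * a) ∧ let S : Set (EuclideanSpace ℝ (Fin 3)) := {p | ∃ m k l : ℤ, p = A (((k : ℝ) • triangularVec₁ a) + ((l : ℝ) • triangularVec₂ a) + ((haggLabel s m : ℝ) • barlowOffset a) + (z m • layerNormal 1))}; (∀ p ∈ S, ‖p‖ ≤ R → ∃ j : Fin N, dist (x j - x i) p ≤ η) ∧ (∀ j : Fin N, ‖x j - x i‖ ≤ R → ∃ p ∈ S, dist (x j - x i) p ≤ η)} : ℝ))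
      ≤ (1 - θ) * (interactionEnergy lennardJones x - (N : ℝ) * P₀.energyPerParticle lennardJones) :=
    mul_le_mul_of_nonneg_left hG (sub_nonneg.2 hθ.le)
  nlinarith [h1, hL]

/-- **The closed skeleton instance**: the crux by name from the three declared stubs (the only
place `sorry` enters). [conjecture] -/
theorem FluxCellKepler_skeleton :
    Summit.AtomisticToContinuum.Crystallization.Theses.FluxTubeKepler.FluxCellKepler :=
  FluxCellKepler_of stub_defectPricedExcess stub_coerciveFluxCells

end Summit.AtomisticToContinuum.Crystallization.Cruxes.FluxCellKepler.Sketch
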